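import Literature.AlgebraicGeometry.Resolution.ResidueFrobeniusClosedBasis
import Literature.AlgebraicGeometry.Resolution.Prop413FromFCBasis
import Literature.AlgebraicGeometry.Resolution.NormalDegreePDefectlessVTGaloisProofs
import Literature.AlgebraicGeometry.Resolution.GaloisDegreePDefectlessProofs
import Literature.AlgebraicGeometry.Resolution.GeneralizedStabilityRationalTrustBase
import HarnessLib

/-!
# The generalized stability theorem over a trivially valued ground field: discharge (Kuhlmann 2010, Thm. 1.1)

Topic: `Literature/AlgebraicGeometry/Resolution` (valued function fields). DISCHARGE of the named
fact `Kuhlmann2010Stability` (`ValuationDefect.lean`) = F.-V. Kuhlmann, *Elimination of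
ramification I: The generalized stability theorem*, Trans. Amer. Math. Soc. 362 (2010)
5697–5727 = arXiv:1003.5678, **Thm. 1.1** ("Let `(F|K, v)` be a valued function field without
transcendence defect. If `(K, v)` is a defectless field, then `(F, v)` is a defectless field")
over a trivially valued ground field, together with the last leaf of its decomposition in this
directory, **Prop. 4.13** (`Kuhlmann2010Prop413ResidueDegree`, `NormalDegreePDefectlessGalois.lean`:
the mixed characteristic residue-transcendental Kummer normal form, "In all cases, `[Ē:F̄] = p`").

State of the decomposition before this file (all PROVED in the tree):
`Kuhlmann2010Stability.of_residueLeaves` (`NormalDegreePDefectlessVTGaloisProofs.lean`: Thm. 1.1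
from Props. 4.12–4.13, everything else along §5 — Lemmas 5.1–5.5, Cor. 2.25, Prop. 2.18,
Prop. 3.1, Lemma 2.27, Props. 4.5–4.6, Ostrowski's lemma, the fundamental inequality — being
proved), `Kuhlmann2010GaloisResidueDegreeEqChar_holds` (`GaloisDegreePDefectlessProofs.lean`:
Prop. 4.12), and `Kuhlmann2010Prop413ResidueDegree.of_gradedFrobeniusClosedBasis`
(`Prop413FromFCBasis.lean`: Prop. 4.13 from the existence, for the residue function field `F̄|K̄`
of every field `F` of the class `IsHenselizedInertiallyGeneratedRT V K`, of a `K̄`-basis of the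
graded Frobenius-closed form `{1} ∪ {s̄ⱼ^{pⁿ} | j ∈ J, n ≥ 0}` — [K5] = F.-V. Kuhlmann, Lect.
Notes Log. 26 (2006), Thm. 10, quoted in the proof of Lemma 4.7 / Lemma 4.11).

This file PROVES that remaining input: `ResidueFrobeniusClosedBasis.lean` already constructs a
Frobenius-closed basis of `F̄|K̄` through the pole filtration `W` of `F̄` at the places of `x̄`
and `x̄⁻¹` (`Literature.FieldTheory.FunctionField.exists_adicPoleFiltration`) and the
graded-complement construction of `Literature.FieldTheory.FunctionField` (`fcVec p hperf W`, index
type `Unit ⊕ (sIndex × ℕ)`, `⋆ ↦ 1`, `(j, n) ↦ 𝔰ⱼ^{pⁿ}`), but exports it in the ungraded form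
"`b i₁ = 1`, `p`-th powers stay in the family". Re-running the same construction and keeping
the grading (`fcVec_linearIndependent`, `span_fcVec_eq_top`) gives the graded form verbatim,
whence Prop. 4.13, Cor. 4.2, Thm. 1.1 for `K(t)` and Thm. 1.1.

## Content (everything PROVED; no definitions, no new named facts)

* `exists_gradedFrobeniusClosed_residue_basis` — [K5] Thm. 10 in graded form for `F̄|K̄`, `F`
  in the class `IsHenselizedInertiallyGeneratedRT V K` over an algebraically closed `K ≤ Ω`.
* `Kuhlmann2010Prop413ResidueDegree_holds` — **DISCHARGE** of Prop. 4.13.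
* `Kuhlmann2010GaloisDegreePDefectless_holds` — **DISCHARGE** of Cor. 4.2
  (`Kuhlmann2010GaloisDegreePDefectless.of_residueDegree`).
* `Kuhlmann2010StabilityRational_holds` — **DISCHARGE** of Thm. 1.1 for `k(x, y)`
  (`Kuhlmann2010StabilityRational.of_leaves`).
* `Kuhlmann2010Stability_holds` — **DISCHARGE** of Thm. 1.1 over a trivially valued ground
  field (`Kuhlmann2010Stability.of_residueLeaves`).

## Sources

* F.-V. Kuhlmann, *Elimination of ramification I: The generalized stability theorem*, Trans.
  Amer. Math. Soc. 362 (2010) 5697–5727 = arXiv:1003.5678: Thm. 1.1, §4 (Cor. 4.2, Lemma 4.11,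
  Prop. 4.13), §5 (pp. 18–20). [Kuhlmann2010]
* F.-V. Kuhlmann, *Additive polynomials and their role in the model theory of valued fields*,
  Lect. Notes Log. 26 (2006) 160–203 = arXiv:1003.5683, §5, Thm. 10. [Kuhlmann2006]
-/

noncomputable section

open IsLocalRing Polynomial

namespace Literature.AlgebraicGeometry.Resolution

universe u

/-! ### [K5] Thm. 10 in graded form for the residue fields of the class -/

section ResidueBasis

variable {Ω : Type u} [Field Ω] (V : ValuationSubring Ω)

/-- **A graded Frobenius-closed `K̄`-basis `{1} ∪ {s̄ⱼ^{pⁿ}}` of `F̄`** for `F` in the class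
`IsHenselizedInertiallyGeneratedRT V K` over an algebraically closed `K ≤ Ω` ([K5] = Kuhlmann
2006, Thm. 10, in the graded form in which Frobenius-closed bases are constructed, as consumed by
Kuhlmann 2010, Lemma 4.11 / Prop. 4.13): there are `s̄ⱼ ∈ F̄ = residueSubfield F V`, `j ∈ J`,
such that the family `⋆ ↦ 1`, `(j, n) ↦ s̄ⱼ^{pⁿ}` on `Unit ⊕ (J × ℕ)` is linearly independent
over `K̄ = residueSubfield K V` and spans `F̄`. PROVED: the pole filtration `W` of `F̄` at the
places of `x̄` and of `x̄⁻¹` (`exists_adicPoleFiltration`, twice) has bottom piece `K̄` (every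
valuation ring of `F̄|K̄` contains `x̄` or `x̄⁻¹`; `K̄` is algebraically closed), and the graded
complement construction `fcVec` of `Literature.FieldTheory.FunctionField` on `W` is linearly
independent (`fcVec_linearIndependent`) and spanning (`span_fcVec_eq_top`) — the argument of
`exists_frobeniusClosed_residue_basis`, keeping the grading. [cite: Kuhlmann2006, Thm. 10] -/
theorem exists_gradedFrobeniusClosed_residue_basis [IsAlgClosed Ω] (p : ℕ) [hp : Fact p.Prime]
    [CharP (ResidueField V) p] {K F : Subfield Ω} (hK : IsAlgClosed K)
    (hF : IsHenselizedInertiallyGeneratedRT V K F) :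
    ∃ (J : Type u) (sbar : J → ResidueField V), (∀ j, sbar j ∈ residueSubfield F V) ∧
      LinearIndependent (residueSubfield K V)
        (Sum.elim (fun _ : Unit => (1 : ResidueField V)) (fun jn : J × ℕ => sbar jn.1 ^ p ^ jn.2)) ∧
      ∀ r ∈ residueSubfield F V, r ∈ Submodule.span (residueSubfield K V)
        (Set.range (Sum.elim (fun _ : Unit => (1 : ResidueField V))
          (fun jn : J × ℕ => sbar jn.1 ^ p ^ jn.2))) := by
  classical
  obtain ⟨x, hx, -, hunr⟩ := id hF
  have hKF : K ≤ F := hF.base_le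
  have hxF : x ∈ F := hunr.le (le_henselization V _ (IntermediateField.mem_adjoin_simple_self K x))
  haveI := hK
  haveI hKbac : IsAlgClosed (residueSubfield K V) := isAlgClosed_residueSubfield (K := K) V
  -- `x̄` is transcendental over `K̄`, and so is `x̄⁻¹`
  obtain ⟨hxV, htr⟩ := hx
  rw [← residueSubfield_subfield_eq_resField V K, ← resid_of_mem V hxV] at htr
  have htr' : Transcendental (residueSubfield K V) (resid V x)⁻¹ := fun h =>
    htr (by simpa using h.inv)
  -- `L = K̄(x̄)`, `E = F̄` as intermediate fields
  set Lt : IntermediateField (residueSubfield K V) (ResidueField V) :=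
    IntermediateField.adjoin (residueSubfield K V) ({resid V x} : Set (ResidueField V)) with hLt
  have hL : Lt.toSubfield =
      residueSubfield (henselization V (IntermediateField.adjoin K ({x} : Set Ω)).toSubfield) V :=
    toSubfield_adjoin_resid_eq V ⟨hxV, by
      rw [← residueSubfield_subfield_eq_resField V K, ← resid_of_mem V hxV]; exact htr⟩
  have hKbF : ∀ c : residueSubfield K V,
      algebraMap (residueSubfield K V) (ResidueField V) c ∈ residueSubfield F V := fun c =>
    residueSubfield_subfield_mono hKF c.2
  have hxbF : resid V x ∈ residueSubfield F V := resid_mem_residueSubfield V hxF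
  have hLF : Lt ≤ (residueSubfield F V).toIntermediateField hKbF :=
    IntermediateField.adjoin_le_iff.mpr (Set.singleton_subset_iff.mpr hxbF)
  -- `F̄` as an intermediate field over `K̄`, made into an algebra over `L = K̄(x̄)`
  set Fb : IntermediateField (residueSubfield K V) (ResidueField V) :=
    (residueSubfield F V).toIntermediateField hKbF with hFb
  have hmemFb : ∀ z, z ∈ Fb ↔ z ∈ residueSubfield F V := fun z => Iff.rfl
  letI algLF : Algebra Lt Fb := (IntermediateField.inclusion hLF).toRingHom.toAlgebra
  have halgLF : ∀ z : Lt, ((algebraMap Lt Fb z : Fb) : ResidueField V) = (z : ResidueField V) :=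
    fun z => rfl
  haveI : IsScalarTower (residueSubfield K V) Lt Fb := IsScalarTower.of_algebraMap_eq fun c => rfl
  -- `F̄|L` is separable …
  have hLres : ∀ z, z ∈ Lt ↔ z ∈ residueSubfield
      (henselization V (IntermediateField.adjoin K ({x} : Set Ω)).toSubfield) V := fun z => by
    rw [← IntermediateField.mem_toSubfield, hL]
  have hsepL : ∀ r ∈ residueSubfield F V, IsSeparable Lt r := by
    intro r hr
    obtain ⟨-, -, -, hsepHF, -⟩ := hunr
    let g : residueSubfield (henselization V (IntermediateField.adjoin K ({x} : Set Ω)).toSubfield) V →+*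
        Lt :=
      { toFun := fun c => ⟨c.1, (hLres _).mpr c.2⟩
        map_one' := rfl
        map_mul' := fun _ _ => rfl
        map_zero' := rfl
        map_add' := fun _ _ => rfl }
    exact isSeparable_of_ringHom_comp_eq g (RingHom.ext fun _ => rfl) (hsepHF r hr)
  let valL : Fb →ₐ[Lt] ResidueField V :=
    { toRingHom := algebraMap Fb (ResidueField V)
      commutes' := fun z => rfl }
  haveI : Algebra.IsSeparable Lt Fb :=
    ⟨fun z => IsSeparable.of_algHom valL (hsepL z.1 ((hmemFb z.1).mp z.2))⟩
  -- … and finite, by comparison with the intermediate field `E` over `L` with underlying set `F̄`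
  obtain ⟨-, hfdE, -⟩ := finrank_residue_extension V hunr (residueSubfield K V) Lt hL hKbF hLF
  haveI := hfdE
  let gE : Fb →ₗ[Lt] IntermediateField.extendScalars hLF :=
    { toFun := fun z => ⟨z.1, (IntermediateField.mem_extendScalars (h := hLF)).mpr z.2⟩
      map_add' := fun _ _ => rfl
      map_smul' := fun c z => Subtype.ext (by
        change (((algebraMap Lt Fb c) * z : Fb) : ResidueField V) = (c : ResidueField V) * (z : ResidueField V)
        rfl) }
  haveI : FiniteDimensional Lt Fb :=
    Module.Finite.of_injective gE fun z w h => Subtype.ext (congrArg Subtype.val h)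
  haveI : CharP Fb p :=
    (algebraMap Fb (ResidueField V)).charP (algebraMap Fb (ResidueField V)).injective p
  -- `RatFunc K̄ ≅ K̄(x̄)` in two ways: `X ↦ x̄` and `X ↦ x̄⁻¹`
  set e₁ : RatFunc (residueSubfield K V) ≃ₐ[residueSubfield K V] Lt :=
    RatFunc.algEquivOfTranscendental (resid V x) htr with he₁
  have hadj : IntermediateField.adjoin (residueSubfield K V) ({(resid V x)⁻¹} : Set (ResidueField V)) =
      Lt := by
    apply le_antisymm
    · exact IntermediateField.adjoin_simple_le_iff.mpr
        (inv_mem (IntermediateField.mem_adjoin_simple_self _ _))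
    · refine IntermediateField.adjoin_simple_le_iff.mpr ?_
      have h1 := IntermediateField.mem_adjoin_simple_self (residueSubfield K V) (resid V x)⁻¹
      have h2 := inv_mem h1
      rwa [inv_inv] at h2
  set e₂ : RatFunc (residueSubfield K V) ≃ₐ[residueSubfield K V] Lt :=
    (RatFunc.algEquivOfTranscendental (resid V x)⁻¹ htr').trans (IntermediateField.equivOfEq hadj)
    with he₂
  have ht₁ : ((algebraMap Lt Fb (e₁ RatFunc.X) : Fb) : ResidueField V) = resid V x := by
    rw [halgLF, he₁, RatFunc.algEquivOfTranscendental_X]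
  have ht₂ : ((algebraMap Lt Fb (e₂ RatFunc.X) : Fb) : ResidueField V) = (resid V x)⁻¹ := by
    rw [halgLF, he₂, AlgEquiv.trans_apply, IntermediateField.equivOfEq_apply,
      RatFunc.algEquivOfTranscendental_X]
  have ht₁₂ : algebraMap Lt Fb (e₂ RatFunc.X) = (algebraMap Lt Fb (e₁ RatFunc.X))⁻¹ := by
    apply Subtype.ext
    rw [ht₂, IntermediateField.coe_inv, ht₁]
  -- the two pole filtrations and their intersection
  obtain ⟨P₁, hmono₁, hroot₁, hexh₁, hzero₁⟩ :=
    Literature.FieldTheory.FunctionField.exists_adicPoleFiltration (residueSubfield K V) Lt Fb e₁ p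
      hp.out.pos
  obtain ⟨P₂, hmono₂, hroot₂, hexh₂, hzero₂⟩ :=
    Literature.FieldTheory.FunctionField.exists_adicPoleFiltration (residueSubfield K V) Lt Fb e₂ p
      hp.out.pos
  set W : ℕ → Submodule (residueSubfield K V) Fb := fun d => P₁ d ⊓ P₂ d with hW
  have hmono : Monotone W := fun d d' h => inf_le_inf (hmono₁ h) (hmono₂ h)
  have hexh : ∀ f : Fb, ∃ d, f ∈ W d := by
    intro f
    obtain ⟨d₁, h₁⟩ := hexh₁ f
    obtain ⟨d₂, h₂⟩ := hexh₂ f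
    exact ⟨max d₁ d₂, hmono₁ (le_max_left _ _) h₁, hmono₂ (le_max_right _ _) h₂⟩
  have hroot : ∀ (f : Fb) (d : ℕ), f ^ p ∈ W d → f ∈ W (d / p) := fun f d h =>
    ⟨hroot₁ f d h.1, hroot₂ f d h.2⟩
  have h0 : ∀ f : Fb, f ∈ W 0 →
      ∃ c : residueSubfield K V, algebraMap (residueSubfield K V) Fb c = f := by
    intro f hf
    have hO : ∀ O : ValuationSubring Fb,
        Set.range (algebraMap (residueSubfield K V) Fb) ⊆ O → f ∈ O := by
      intro O hkO
      rcases O.mem_or_inv_mem (algebraMap Lt Fb (e₁ RatFunc.X)) with h | h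
      · exact hzero₁ f hf.1 O hkO h
      · rw [← ht₁₂] at h
        exact hzero₂ f hf.2 O hkO h
    exact mem_range_of_isIntegral_of_isAlgClosed (isIntegral_of_forall_valuationSubring_mem hO)
  have hperf : ∀ c : residueSubfield K V, ∃ c' : residueSubfield K V, c' ^ p = c := fun c =>
    IsAlgClosed.exists_pow_nat_eq c hp.out.pos
  -- the graded Frobenius-closed family `fcVec` on `W`: `⋆ ↦ 1`, `(j, n) ↦ 𝔰ⱼ^{pⁿ}`
  have hli := Literature.FieldTheory.FunctionField.fcVec_linearIndependent p hperf (W := W) hmono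
  have hsp := Literature.FieldTheory.FunctionField.span_fcVec_eq_top p hperf (W := W) hexh h0 hroot
  -- push it into `Ωv`
  have hfker : LinearMap.ker Fb.val.toLinearMap = ⊥ :=
    LinearMap.ker_eq_bot.mpr fun z w hzw => Subtype.ext hzw
  have hfam : (Sum.elim (fun _ : Unit => (1 : ResidueField V))
      (fun jn : Literature.FieldTheory.FunctionField.sIndex p hperf W × ℕ =>
        ((Literature.FieldTheory.FunctionField.sVec p hperf W jn.1 : Fb) : ResidueField V) ^ p ^ jn.2)) =
      Fb.val.toLinearMap ∘ Literature.FieldTheory.FunctionField.fcVec p hperf W := by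
    funext i
    rcases i with u | ⟨j, n⟩
    · rfl
    · rfl
  refine ⟨Literature.FieldTheory.FunctionField.sIndex p hperf W,
    fun j => ((Literature.FieldTheory.FunctionField.sVec p hperf W j : Fb) : ResidueField V),
    fun j => (hmemFb _).mp (Literature.FieldTheory.FunctionField.sVec p hperf W j).2, ?_, ?_⟩
  · have key := hli.map' Fb.val.toLinearMap hfker
    rw [← hfam] at key
    exact key
  · intro r hr
    have hr' : (⟨r, (hmemFb r).mpr hr⟩ : Fb) ∈ Submodule.span (residueSubfield K V)
        (Set.range (Literature.FieldTheory.FunctionField.fcVec p hperf W)) := by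
      rw [hsp]
      exact Submodule.mem_top
    have h2 := Submodule.mem_map_of_mem (f := Fb.val.toLinearMap) hr'
    rw [Submodule.map_span, ← Set.range_comp, ← hfam] at h2
    exact h2

end ResidueBasis

/-! ### The discharges -/

/-- **DISCHARGE of `Kuhlmann2010Prop413ResidueDegree`** (Kuhlmann 2010, Prop. 4.13 with
Lemma 4.11: in the mixed characteristic residue-transcendental case, `[Ē : F̄] = p` for every
Galois extension `E|F` of degree `p`): `Kuhlmann2010Prop413ResidueDegree.of_gradedFrobeniusClosedBasis`
(`Prop413FromFCBasis.lean`) applied to `exists_gradedFrobeniusClosed_residue_basis` ([K5] Thm. 10).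
PROVED. [cite: Kuhlmann2010, Prop. 4.13 (last assertion) and Lemma 4.11] -/
theorem Kuhlmann2010Prop413ResidueDegree_holds : Kuhlmann2010Prop413ResidueDegree.{u} :=
  Kuhlmann2010Prop413ResidueDegree.of_gradedFrobeniusClosedBasis
    fun _ _ _ _ V p _ hp _ _ hK hF =>
      haveI : Fact p.Prime := ⟨hp⟩
      exists_gradedFrobeniusClosed_residue_basis V p hK hF

/-- **DISCHARGE of `Kuhlmann2010GaloisDegreePDefectless`** (Kuhlmann 2010, Cor. 4.2: Galois
extensions of degree `p` of the fields of the class are defectless), from Prop. 4.12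
(`Kuhlmann2010GaloisResidueDegreeEqChar_holds`) and Prop. 4.13
(`Kuhlmann2010Prop413ResidueDegree_holds`) through
`Kuhlmann2010GaloisDegreePDefectless.of_residueDegree`. PROVED.
[cite: Kuhlmann2010, Cor. 4.2 (with Prop. 4.1, Props. 4.12–4.13)] -/
theorem Kuhlmann2010GaloisDegreePDefectless_holds : Kuhlmann2010GaloisDegreePDefectless.{u} :=
  Kuhlmann2010GaloisDegreePDefectless.of_residueDegree Kuhlmann2010GaloisResidueDegreeEqChar_holds
    Kuhlmann2010Prop413ResidueDegree_holds

/-- **DISCHARGE of `Kuhlmann2010StabilityRational`** (Kuhlmann 2010, Thm. 1.1 for the rational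
function field `k(x, y)` over a trivially valued `k`), through
`Kuhlmann2010StabilityRational.of_leaves` (`GeneralizedStabilityRationalTrustBase.lean`) and the
three normal forms of §4 (`Kuhlmann2010Prop46ValueIndex_holds`,
`Kuhlmann2010GaloisResidueDegreeEqChar_holds`, `Kuhlmann2010Prop413ResidueDegree_holds`). PROVED.
[cite: Kuhlmann2010, Thm. 1.1] -/
theorem Kuhlmann2010StabilityRational_holds : Kuhlmann2010StabilityRational.{u} :=
  Kuhlmann2010StabilityRational.of_leaves Kuhlmann2010Prop46ValueIndex_holds
    Kuhlmann2010GaloisResidueDegreeEqChar_holds Kuhlmann2010Prop413ResidueDegree_holds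

/-- **DISCHARGE of `Kuhlmann2010Stability`** (Kuhlmann 2010, Thm. 1.1, the generalized stability
theorem over a trivially valued ground field: a valued function field without transcendence
defect over a defectless — here trivially valued — ground field is defectless), through
`Kuhlmann2010Stability.of_residueLeaves` (`NormalDegreePDefectlessVTGaloisProofs.lean`: §5 with
Cor. 2.25, Props. 4.5–4.6, Ostrowski's lemma and the fundamental inequality, all proved) applied
to Prop. 4.12 (`Kuhlmann2010GaloisResidueDegreeEqChar_holds`) and Prop. 4.13
(`Kuhlmann2010Prop413ResidueDegree_holds`). PROVED.
[cite: Kuhlmann2010, Thm. 1.1 (proof: Section 5, pp. 18–20, with Cor. 4.2)] -/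
theorem Kuhlmann2010Stability_holds : Kuhlmann2010Stability.{u} :=
  Kuhlmann2010Stability.of_residueLeaves Kuhlmann2010GaloisResidueDegreeEqChar_holds
    Kuhlmann2010Prop413ResidueDegree_holds

end Literature.AlgebraicGeometry.Resolution
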